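import Summits.Ventures.Crystal3D.Theorems.StickyWulffConstantGenericWallFloorDoubleTopLocalCoaxial
import Summits.Ventures.Crystal3D.Theorems.StickyWulffConstantGenericWallFloorStarPairLocalFrame
import Summits.Ventures.Crystal3D.Theorems.StickyWulffConstantGenericWallFloorStarPairLocalData3
import HarnessLib

/-!
# Stars-only double stars, local atlas B: every star certificate ball contains only its co-axial configuration
# (crux `GenericWallFloor`, line `WallLedgerG`; input `StarPairCoaxial` of the localised stack ledger)

HONEST FRAMING. Part of the venture `Summits/Ventures/Crystal3D` (cell `crystal3d-full`), helper
`--supports` the crux `GenericWallFloor` (stmt-Ventures-19480) of `route-Ventures-StickyWulffConstant`,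
registered line `WallLedgerG`, open stub `stub_twoSlabAdhesion`.  Star version of wulff-p2's `…DoubleTopLocalAtlasA/B`:
for each star-supported record `star_…` of `…StarPairLocalData3` the chain `star_…_valid`/`star_…_supp` (decide) →
`DTCert.eq_of_isometry_star` (`…StarPairLocalFrame`) → `coaxial_of_cubicMat_lattice` / `coaxial_of_cubicMat_twin`
(`…DoubleTopLocalCoaxial`; slot-permutation side condition by `decide +kernel`, the reference rotations `B` being those of
R39d) packaged into ONE statement in the tree's vocabulary with STAR hypotheses only: for a linear isometry `R` and a point
`y`, if the five star balls `wPt i`, `i ∈ starIdx`, and their `R`-images are `1`-separated up to coincidence, `y` is a unit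
vector at distance `≥ 1` from these ten balls, and `(R, y)` lies in the record's ball, then `(Λ₀, R·Λ₀)` is CO-AXIAL
(frame form of `coaxial_iff_common_frame`).  These balls are exactly what the star interval certificate (lit g13,
kit j298152–5) leaves out.
WHAT THIS IS NOT: the global half, the slot normalisation, the ledger glue; rung F-C1 not moved.
-/

noncomputable section
namespace Summit.Ventures.Crystal3D.Theorems
open Matrix NearIdentity
open Literature.MathematicalPhysics.StatisticalMechanics (fccStacking barlowStacking)

/-- The ball of `star_b17` contains only the co-axial configuration (lattice symmetry); STAR hypotheses only. -/
theorem star_b17_coaxial (R : EuclideanSpace ℝ (Fin 3) ≃ₗᵢ[ℝ] EuclideanSpace ℝ (Fin 3))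
    (y : EuclideanSpace ℝ (Fin 3))
    (hclus : ∀ i ∈ starIdx, ∀ j ∈ starIdx, wPt i = R (wPt j) ∨ 1 ≤ dist (wPt i) (R (wPt j)))
    (hy : ‖y‖ = 1) (hyF : ∀ i ∈ starIdx, 1 ≤ dist y (wPt i)) (hyM : ∀ j ∈ starIdx, 1 ≤ dist y (R (wPt j)))
    (hsmall : frob (cubicMat R * star_b17.bRᵀ - 1) + (if star_b17.useY then 2 * ‖y - star_b17.y0E‖ ^ 2 else 0) <
      1 / star_b17.Ktot) :
    ∃ L : EuclideanSpace ℝ (Fin 3) ≃ₗᵢ[ℝ] EuclideanSpace ℝ (Fin 3),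
      (fccStacking 1 (Real.sqrt (2 / 3)) = L '' fccStacking 1 (Real.sqrt (2 / 3)) ∨
        fccStacking 1 (Real.sqrt (2 / 3)) = L '' barlowStacking 1 (Real.sqrt (2 / 3)) (fun _ : ℤ => (-1 : ℤ))) ∧
      (R '' fccStacking 1 (Real.sqrt (2 / 3)) = L '' fccStacking 1 (Real.sqrt (2 / 3)) ∨
        R '' fccStacking 1 (Real.sqrt (2 / 3)) = L '' barlowStacking 1 (Real.sqrt (2 / 3)) (fun _ : ℤ => (-1 : ℤ))) :=
  coaxial_of_cubicMat_lattice R (star_b17.eq_of_isometry_star star_b17_valid star_b17_supp R y hclus (fun _ => hy) (fun _ => hyF) (fun _ => hyM) hsmall) (by decide +kernel)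

/-- The ball of `star_b18` contains only the co-axial configuration (lattice symmetry); STAR hypotheses only. -/
theorem star_b18_coaxial (R : EuclideanSpace ℝ (Fin 3) ≃ₗᵢ[ℝ] EuclideanSpace ℝ (Fin 3))
    (y : EuclideanSpace ℝ (Fin 3))
    (hclus : ∀ i ∈ starIdx, ∀ j ∈ starIdx, wPt i = R (wPt j) ∨ 1 ≤ dist (wPt i) (R (wPt j)))
    (hy : ‖y‖ = 1) (hyF : ∀ i ∈ starIdx, 1 ≤ dist y (wPt i)) (hyM : ∀ j ∈ starIdx, 1 ≤ dist y (R (wPt j)))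
    (hsmall : frob (cubicMat R * star_b18.bRᵀ - 1) + (if star_b18.useY then 2 * ‖y - star_b18.y0E‖ ^ 2 else 0) <
      1 / star_b18.Ktot) :
    ∃ L : EuclideanSpace ℝ (Fin 3) ≃ₗᵢ[ℝ] EuclideanSpace ℝ (Fin 3),
      (fccStacking 1 (Real.sqrt (2 / 3)) = L '' fccStacking 1 (Real.sqrt (2 / 3)) ∨
        fccStacking 1 (Real.sqrt (2 / 3)) = L '' barlowStacking 1 (Real.sqrt (2 / 3)) (fun _ : ℤ => (-1 : ℤ))) ∧
      (R '' fccStacking 1 (Real.sqrt (2 / 3)) = L '' fccStacking 1 (Real.sqrt (2 / 3)) ∨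
        R '' fccStacking 1 (Real.sqrt (2 / 3)) = L '' barlowStacking 1 (Real.sqrt (2 / 3)) (fun _ : ℤ => (-1 : ℤ))) :=
  coaxial_of_cubicMat_lattice R (star_b18.eq_of_isometry_star star_b18_valid star_b18_supp R y hclus (fun _ => hy) (fun _ => hyF) (fun _ => hyM) hsmall) (by decide +kernel)

/-- The ball of `star_b19` contains only the co-axial configuration (lattice symmetry); STAR hypotheses only. -/
theorem star_b19_coaxial (R : EuclideanSpace ℝ (Fin 3) ≃ₗᵢ[ℝ] EuclideanSpace ℝ (Fin 3))
    (y : EuclideanSpace ℝ (Fin 3))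
    (hclus : ∀ i ∈ starIdx, ∀ j ∈ starIdx, wPt i = R (wPt j) ∨ 1 ≤ dist (wPt i) (R (wPt j)))
    (hy : ‖y‖ = 1) (hyF : ∀ i ∈ starIdx, 1 ≤ dist y (wPt i)) (hyM : ∀ j ∈ starIdx, 1 ≤ dist y (R (wPt j)))
    (hsmall : frob (cubicMat R * star_b19.bRᵀ - 1) + (if star_b19.useY then 2 * ‖y - star_b19.y0E‖ ^ 2 else 0) <
      1 / star_b19.Ktot) :
    ∃ L : EuclideanSpace ℝ (Fin 3) ≃ₗᵢ[ℝ] EuclideanSpace ℝ (Fin 3),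
      (fccStacking 1 (Real.sqrt (2 / 3)) = L '' fccStacking 1 (Real.sqrt (2 / 3)) ∨
        fccStacking 1 (Real.sqrt (2 / 3)) = L '' barlowStacking 1 (Real.sqrt (2 / 3)) (fun _ : ℤ => (-1 : ℤ))) ∧
      (R '' fccStacking 1 (Real.sqrt (2 / 3)) = L '' fccStacking 1 (Real.sqrt (2 / 3)) ∨
        R '' fccStacking 1 (Real.sqrt (2 / 3)) = L '' barlowStacking 1 (Real.sqrt (2 / 3)) (fun _ : ℤ => (-1 : ℤ))) :=
  coaxial_of_cubicMat_lattice R (star_b19.eq_of_isometry_star star_b19_valid star_b19_supp R y hclus (fun _ => hy) (fun _ => hyF) (fun _ => hyM) hsmall) (by decide +kernel)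

/-- The ball of `star_b20` contains only the co-axial configuration (lattice symmetry); STAR hypotheses only. -/
theorem star_b20_coaxial (R : EuclideanSpace ℝ (Fin 3) ≃ₗᵢ[ℝ] EuclideanSpace ℝ (Fin 3))
    (y : EuclideanSpace ℝ (Fin 3))
    (hclus : ∀ i ∈ starIdx, ∀ j ∈ starIdx, wPt i = R (wPt j) ∨ 1 ≤ dist (wPt i) (R (wPt j)))
    (hy : ‖y‖ = 1) (hyF : ∀ i ∈ starIdx, 1 ≤ dist y (wPt i)) (hyM : ∀ j ∈ starIdx, 1 ≤ dist y (R (wPt j)))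
    (hsmall : frob (cubicMat R * star_b20.bRᵀ - 1) + (if star_b20.useY then 2 * ‖y - star_b20.y0E‖ ^ 2 else 0) <
      1 / star_b20.Ktot) :
    ∃ L : EuclideanSpace ℝ (Fin 3) ≃ₗᵢ[ℝ] EuclideanSpace ℝ (Fin 3),
      (fccStacking 1 (Real.sqrt (2 / 3)) = L '' fccStacking 1 (Real.sqrt (2 / 3)) ∨
        fccStacking 1 (Real.sqrt (2 / 3)) = L '' barlowStacking 1 (Real.sqrt (2 / 3)) (fun _ : ℤ => (-1 : ℤ))) ∧
      (R '' fccStacking 1 (Real.sqrt (2 / 3)) = L '' fccStacking 1 (Real.sqrt (2 / 3)) ∨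
        R '' fccStacking 1 (Real.sqrt (2 / 3)) = L '' barlowStacking 1 (Real.sqrt (2 / 3)) (fun _ : ℤ => (-1 : ℤ))) :=
  coaxial_of_cubicMat_lattice R (star_b20.eq_of_isometry_star star_b20_valid star_b20_supp R y hclus (fun _ => hy) (fun _ => hyF) (fun _ => hyM) hsmall) (by decide +kernel)

/-- The ball of `star_b21` contains only the co-axial configuration (lattice symmetry); STAR hypotheses only. -/
theorem star_b21_coaxial (R : EuclideanSpace ℝ (Fin 3) ≃ₗᵢ[ℝ] EuclideanSpace ℝ (Fin 3))
    (y : EuclideanSpace ℝ (Fin 3))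
    (hclus : ∀ i ∈ starIdx, ∀ j ∈ starIdx, wPt i = R (wPt j) ∨ 1 ≤ dist (wPt i) (R (wPt j)))
    (hy : ‖y‖ = 1) (hyF : ∀ i ∈ starIdx, 1 ≤ dist y (wPt i)) (hyM : ∀ j ∈ starIdx, 1 ≤ dist y (R (wPt j)))
    (hsmall : frob (cubicMat R * star_b21.bRᵀ - 1) + (if star_b21.useY then 2 * ‖y - star_b21.y0E‖ ^ 2 else 0) <
      1 / star_b21.Ktot) :
    ∃ L : EuclideanSpace ℝ (Fin 3) ≃ₗᵢ[ℝ] EuclideanSpace ℝ (Fin 3),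
      (fccStacking 1 (Real.sqrt (2 / 3)) = L '' fccStacking 1 (Real.sqrt (2 / 3)) ∨
        fccStacking 1 (Real.sqrt (2 / 3)) = L '' barlowStacking 1 (Real.sqrt (2 / 3)) (fun _ : ℤ => (-1 : ℤ))) ∧
      (R '' fccStacking 1 (Real.sqrt (2 / 3)) = L '' fccStacking 1 (Real.sqrt (2 / 3)) ∨
        R '' fccStacking 1 (Real.sqrt (2 / 3)) = L '' barlowStacking 1 (Real.sqrt (2 / 3)) (fun _ : ℤ => (-1 : ℤ))) :=
  coaxial_of_cubicMat_lattice R (star_b21.eq_of_isometry_star star_b21_valid star_b21_supp R y hclus (fun _ => hy) (fun _ => hyF) (fun _ => hyM) hsmall) (by decide +kernel)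

/-- The ball of `star_b22` contains only the co-axial configuration (lattice symmetry); STAR hypotheses only. -/
theorem star_b22_coaxial (R : EuclideanSpace ℝ (Fin 3) ≃ₗᵢ[ℝ] EuclideanSpace ℝ (Fin 3))
    (y : EuclideanSpace ℝ (Fin 3))
    (hclus : ∀ i ∈ starIdx, ∀ j ∈ starIdx, wPt i = R (wPt j) ∨ 1 ≤ dist (wPt i) (R (wPt j)))
    (hy : ‖y‖ = 1) (hyF : ∀ i ∈ starIdx, 1 ≤ dist y (wPt i)) (hyM : ∀ j ∈ starIdx, 1 ≤ dist y (R (wPt j)))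
    (hsmall : frob (cubicMat R * star_b22.bRᵀ - 1) + (if star_b22.useY then 2 * ‖y - star_b22.y0E‖ ^ 2 else 0) <
      1 / star_b22.Ktot) :
    ∃ L : EuclideanSpace ℝ (Fin 3) ≃ₗᵢ[ℝ] EuclideanSpace ℝ (Fin 3),
      (fccStacking 1 (Real.sqrt (2 / 3)) = L '' fccStacking 1 (Real.sqrt (2 / 3)) ∨
        fccStacking 1 (Real.sqrt (2 / 3)) = L '' barlowStacking 1 (Real.sqrt (2 / 3)) (fun _ : ℤ => (-1 : ℤ))) ∧
      (R '' fccStacking 1 (Real.sqrt (2 / 3)) = L '' fccStacking 1 (Real.sqrt (2 / 3)) ∨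
        R '' fccStacking 1 (Real.sqrt (2 / 3)) = L '' barlowStacking 1 (Real.sqrt (2 / 3)) (fun _ : ℤ => (-1 : ℤ))) :=
  coaxial_of_cubicMat_lattice R (star_b22.eq_of_isometry_star star_b22_valid star_b22_supp R y hclus (fun _ => hy) (fun _ => hyF) (fun _ => hyM) hsmall) (by decide +kernel)

/-- The ball of `star_b23` contains only the co-axial configuration (lattice symmetry); STAR hypotheses only. -/
theorem star_b23_coaxial (R : EuclideanSpace ℝ (Fin 3) ≃ₗᵢ[ℝ] EuclideanSpace ℝ (Fin 3))
    (y : EuclideanSpace ℝ (Fin 3))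
    (hclus : ∀ i ∈ starIdx, ∀ j ∈ starIdx, wPt i = R (wPt j) ∨ 1 ≤ dist (wPt i) (R (wPt j)))
    (hy : ‖y‖ = 1) (hyF : ∀ i ∈ starIdx, 1 ≤ dist y (wPt i)) (hyM : ∀ j ∈ starIdx, 1 ≤ dist y (R (wPt j)))
    (hsmall : frob (cubicMat R * star_b23.bRᵀ - 1) + (if star_b23.useY then 2 * ‖y - star_b23.y0E‖ ^ 2 else 0) <
      1 / star_b23.Ktot) :
    ∃ L : EuclideanSpace ℝ (Fin 3) ≃ₗᵢ[ℝ] EuclideanSpace ℝ (Fin 3),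
      (fccStacking 1 (Real.sqrt (2 / 3)) = L '' fccStacking 1 (Real.sqrt (2 / 3)) ∨
        fccStacking 1 (Real.sqrt (2 / 3)) = L '' barlowStacking 1 (Real.sqrt (2 / 3)) (fun _ : ℤ => (-1 : ℤ))) ∧
      (R '' fccStacking 1 (Real.sqrt (2 / 3)) = L '' fccStacking 1 (Real.sqrt (2 / 3)) ∨
        R '' fccStacking 1 (Real.sqrt (2 / 3)) = L '' barlowStacking 1 (Real.sqrt (2 / 3)) (fun _ : ℤ => (-1 : ℤ))) :=
  coaxial_of_cubicMat_lattice R (star_b23.eq_of_isometry_star star_b23_valid star_b23_supp R y hclus (fun _ => hy) (fun _ => hyF) (fun _ => hyM) hsmall) (by decide +kernel)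

/-- The ball of `star_b27` contains only the co-axial configuration (Σ3 twin, mirror slot 8); STAR hypotheses only. -/
theorem star_b27_coaxial (R : EuclideanSpace ℝ (Fin 3) ≃ₗᵢ[ℝ] EuclideanSpace ℝ (Fin 3))
    (y : EuclideanSpace ℝ (Fin 3))
    (hclus : ∀ i ∈ starIdx, ∀ j ∈ starIdx, wPt i = R (wPt j) ∨ 1 ≤ dist (wPt i) (R (wPt j)))
    (hy : ‖y‖ = 1) (hyF : ∀ i ∈ starIdx, 1 ≤ dist y (wPt i)) (hyM : ∀ j ∈ starIdx, 1 ≤ dist y (R (wPt j)))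
    (hsmall : frob (cubicMat R * star_b27.bRᵀ - 1) + (if star_b27.useY then 2 * ‖y - star_b27.y0E‖ ^ 2 else 0) <
      1 / star_b27.Ktot) :
    ∃ L : EuclideanSpace ℝ (Fin 3) ≃ₗᵢ[ℝ] EuclideanSpace ℝ (Fin 3),
      (fccStacking 1 (Real.sqrt (2 / 3)) = L '' fccStacking 1 (Real.sqrt (2 / 3)) ∨
        fccStacking 1 (Real.sqrt (2 / 3)) = L '' barlowStacking 1 (Real.sqrt (2 / 3)) (fun _ : ℤ => (-1 : ℤ))) ∧
      (R '' fccStacking 1 (Real.sqrt (2 / 3)) = L '' fccStacking 1 (Real.sqrt (2 / 3)) ∨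
        R '' fccStacking 1 (Real.sqrt (2 / 3)) = L '' barlowStacking 1 (Real.sqrt (2 / 3)) (fun _ : ℤ => (-1 : ℤ))) :=
  coaxial_of_cubicMat_twin R (star_b27.eq_of_isometry_star star_b27_valid star_b27_supp R y hclus (fun _ => hy) (fun _ => hyF) (fun _ => hyM) hsmall) 8 (by decide +kernel)

/-- The ball of `star_b31_p1p0m1` contains only the co-axial configuration (Σ3 twin, mirror slot 8); STAR hypotheses only. -/
theorem star_b31_p1p0m1_coaxial (R : EuclideanSpace ℝ (Fin 3) ≃ₗᵢ[ℝ] EuclideanSpace ℝ (Fin 3))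
    (y : EuclideanSpace ℝ (Fin 3))
    (hclus : ∀ i ∈ starIdx, ∀ j ∈ starIdx, wPt i = R (wPt j) ∨ 1 ≤ dist (wPt i) (R (wPt j)))
    (hy : ‖y‖ = 1) (hyF : ∀ i ∈ starIdx, 1 ≤ dist y (wPt i)) (hyM : ∀ j ∈ starIdx, 1 ≤ dist y (R (wPt j)))
    (hsmall : frob (cubicMat R * star_b31_p1p0m1.bRᵀ - 1) + (if star_b31_p1p0m1.useY then 2 * ‖y - star_b31_p1p0m1.y0E‖ ^ 2 else 0) <
      1 / star_b31_p1p0m1.Ktot) :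
    ∃ L : EuclideanSpace ℝ (Fin 3) ≃ₗᵢ[ℝ] EuclideanSpace ℝ (Fin 3),
      (fccStacking 1 (Real.sqrt (2 / 3)) = L '' fccStacking 1 (Real.sqrt (2 / 3)) ∨
        fccStacking 1 (Real.sqrt (2 / 3)) = L '' barlowStacking 1 (Real.sqrt (2 / 3)) (fun _ : ℤ => (-1 : ℤ))) ∧
      (R '' fccStacking 1 (Real.sqrt (2 / 3)) = L '' fccStacking 1 (Real.sqrt (2 / 3)) ∨
        R '' fccStacking 1 (Real.sqrt (2 / 3)) = L '' barlowStacking 1 (Real.sqrt (2 / 3)) (fun _ : ℤ => (-1 : ℤ))) :=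
  coaxial_of_cubicMat_twin R (star_b31_p1p0m1.eq_of_isometry_star star_b31_p1p0m1_valid star_b31_p1p0m1_supp R y hclus (fun _ => hy) (fun _ => hyF) (fun _ => hyM) hsmall) 8 (by decide +kernel)

end Summit.Ventures.Crystal3D.Theorems

end
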